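import Summits.CriticalPhenomena.PercolationContinuityZ3.Theorems.Transplant.SamePThetaPosOfLawful
import Literature.Probability.Percolation.OrientedHistorySiteRenormalizationHolds
import HarnessLib

/-!
# The PEIERLS HALF for ORIENTED history-driven schemes (N2, frames-only node — the user-facing twin of `SamePThetaPosOfLawful`)

builds on p205010 (kernel theorem, internal audit signed; external expert review pending) — nothing in this file uses p205010; nothing is claimed about the
open node `SamePDropOfSkeletonFrm₁`.  Lane `prim-bschramm`, seat `prim-bschramm-p3` (gen 14; N2 design owner); helper file (`--supports stmt-CriticalPhenomena-4575`);
N2-SCOPE §19.1 (c) (closure tops over `Frm`).  UNCONDITIONAL: B3 is closed (`orientedPeierlsBound_holds`, `OrientedHistorySiteRenormalizationHolds.lean`,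
over the lead's half-count `Contour.exists_dualCircuit_quadrant`):
* **`theta_pos_of_olawful`** — `OLawful q S G p ε` (any quadrant `q`), `ε ≤ 2⁻³²`, `U₀ ⊆ E(G)`, `0 < p`, and "infinite ORIENTED macro-cluster ⇒ `x₀ ↔ ∞`
  (up to `ω ⊄ E(G)`)" give `0 < θ_{x₀}(p)`;  `criticalProb_le_of_olawful` — hence `p_c(G, x₀) ≤ p`.  Proofs = the unoriented ones with
  `measureReal_le_three_mul_of_subset_oriented`.
[cite: KozmaNitzan2024, §1 p. 2 (approach 1), §4 p. 25] [cite: GrimmettPercolation1999, §1.4]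
-/

noncomputable section

open MeasureTheory ProbabilityTheory

namespace Summit.CriticalPhenomena.PercolationContinuityZ3.Theorems

namespace SameP

open Literature.Probability.Percolation Literature.Probability.LatticeModels SimpleGraph

variable {V : Type}

/-- **Peierls half for an ORIENTED-lawful scheme — unconditional** (B3 closed: `orientedPeierlsBound_holds`). A scheme oriented-lawful AT `p` for the
quadrant `q` with `ε ≤ 2⁻³²`, initial edges in `E(G)`, `p > 0`, and whose infinite ORIENTED macro-cluster forces `x₀ ↔ ∞`, gives `θ_{x₀}(p) > 0`.
[cite: KozmaNitzan2024, §1 p. 2 (approach 1)] -/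
theorem theta_pos_of_olawful [Countable V] {q : Fin 2 → Bool} {S : HSiteScheme V} {G : SimpleGraph V} {p : unitInterval} {ε : ℝ}
    (hL : S.OLawful q G p ε) (hε : ε ≤ (1 / 2) ^ 32) (hU : (↑S.U₀ : Set (Sym2 V)) ⊆ G.edgeSet) (hp : 0 < (p : ℝ)) {x₀ : V}
    (hperc : S.initEvent ∩ {ω | (S.ooccFinal q ω).Infinite} ⊆ percolatesAt x₀ ∪ {ω | ¬ω ⊆ G.edgeSet}) :
    0 < theta G x₀ p := by
  have h3 := HSiteScheme.measureReal_le_three_mul_of_subset_oriented hL hε hperc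
  have hA0 := HSiteScheme.initEvent_pos (S := S) (G := G) (p := p) hU hp
  have hN0 : (bondPercolation G p).real {ω | ¬ω ⊆ G.edgeSet} = 0 := by
    rw [measureReal_def, ENNReal.toReal_eq_zero_iff]
    left
    rw [measure_eq_zero_iff_ae_notMem]
    filter_upwards [(ProbabilityTheory.setBernoulli_ae_subset :
      ∀ᵐ ω ∂(bondPercolation G p), ω ⊆ G.edgeSet)] with ω hω using fun h => h hω
  have hUn := measureReal_union_le (μ := bondPercolation G p) (percolatesAt x₀) {ω | ¬ω ⊆ G.edgeSet}
  rw [hN0, add_zero] at hUn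
  unfold theta
  nlinarith [hA0, h3, hUn]

/-- Hence `p_c(G, x₀) ≤ p` for such a scheme at `p` — unconditional. [cite: KozmaNitzan2024, §1 p. 2] -/
theorem criticalProb_le_of_olawful [Countable V] {q : Fin 2 → Bool} {S : HSiteScheme V} {G : SimpleGraph V} {p : unitInterval} {ε : ℝ}
    (hL : S.OLawful q G p ε) (hε : ε ≤ (1 / 2) ^ 32) (hU : (↑S.U₀ : Set (Sym2 V)) ⊆ G.edgeSet) (hp : 0 < (p : ℝ)) {x₀ : V}
    (hperc : S.initEvent ∩ {ω | (S.ooccFinal q ω).Infinite} ⊆ percolatesAt x₀ ∪ {ω | ¬ω ⊆ G.edgeSet}) :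
    criticalProb G x₀ ≤ p :=
  OrbitQuotient.criticalProb_le_of_theta_pos G x₀ p (theta_pos_of_olawful hL hε hU hp hperc)

end SameP

end Summit.CriticalPhenomena.PercolationContinuityZ3.Theorems

end
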